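import Mathlib.RingTheory.Valuation.LocalSubring
import Mathlib.RingTheory.MvPolynomial.Homogeneous
import Mathlib.RingTheory.LocalRing.ResidueField.Basic
import Mathlib.Algebra.CharP.Basic
import Mathlib.Data.Nat.Prime.Int
import HarnessLib

/-!
# Reduction modulo `p` of common projective zeros of integer forms

Helper for the crux `HessianRankCodimTwo` (stmt-ValiantsHypothesis-8061), line `good_plane`: the
number-theoretic hinge of "Theorem P" (the Latin block plane is good for every prime block size,
`Cruxes/HessianRankCodimTwo/GoodPlanesLatinReduction.md` §6).  If finitely or infinitely many
HOMOGENEOUS polynomials with integer coefficients have a common non-trivial zero over a field of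
characteristic `0`, then for every prime `p` they have a common non-trivial zero over some field of
characteristic `p` (`exists_charP_commonZero`).  Proof: Chevalley's extension theorem
(`LocalSubring.exists_le_valuationSubring`) gives a valuation ring `B` of the field dominating
`ℤ_(p)`; rescale the zero by the coordinate of largest valuation so that it lies in `B` with a unit
coordinate, and reduce to the residue field of `B`.
-/

noncomputable section

open MvPolynomial

-- single-conjunct layout `Summits/ValiantsHypothesis/ValiantsHypothesis`: duplicated namespace by design
set_option linter.dupNamespace false

namespace Summit.ValiantsHypothesis.ValiantsHypothesis.Theorems.GrenetZeonHessianRankCodimTwo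

universe u

/-- Homogeneous polynomials scale: `f(c • z) = c^d f(z)`. [folklore] -/
theorem aeval_smul_of_isHomogeneous {σ R A : Type*} [CommRing R] [CommRing A] [Algebra R A]
    {f : MvPolynomial σ R} {d : ℕ} (hf : f.IsHomogeneous d) (c : A) (z : σ → A) :
    aeval (c • z) f = c ^ d * aeval z f := by
  classical
  conv_lhs => rw [f.as_sum]
  conv_rhs => rw [f.as_sum]
  rw [map_sum, map_sum, Finset.mul_sum]
  refine Finset.sum_congr rfl fun m hm => ?_
  rw [aeval_monomial, aeval_monomial]
  have hdeg : d = ∑ i ∈ m.support, m i := hf.degree_eq_sum_deg_support hm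
  rw [Finsupp.prod, Finsupp.prod]
  simp only [Pi.smul_apply, smul_eq_mul, mul_pow, Finset.prod_mul_distrib,
    Finset.prod_pow_eq_pow_sum, ← hdeg]
  ring

/-- A field of characteristic zero has a valuation subring in which the prime `p` is a non-unit
(Chevalley: a valuation ring dominating `ℤ_(p)`). [folklore] -/
theorem exists_valuationSubring_lt_one (K : Type u) [Field K] [CharZero K] (p : ℕ)
    (hp : p.Prime) : ∃ B : ValuationSubring K, B.valuation (p : K) < 1 := by
  classical
  -- the image `A ≅ ℤ` of `ℤ` in `K` and its prime ideal `(p)`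
  let ι : ℤ →+* K := Int.castRingHom K
  let A : Subring K := ι.range
  have hbij : Function.Bijective ι.rangeRestrict :=
    ⟨fun a b h => Int.cast_injective (α := K) (congrArg Subtype.val h),
      ι.rangeRestrict_surjective⟩
  let e : ℤ ≃+* A := RingEquiv.ofBijective ι.rangeRestrict hbij
  let P : Ideal A := Ideal.comap e.symm.toRingHom (Ideal.span {(p : ℤ)})
  have hPprime : (Ideal.span {(p : ℤ)}).IsPrime :=
    (Ideal.span_singleton_prime (by exact_mod_cast hp.ne_zero)).mpr
      (Nat.prime_iff_prime_int.mp hp)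
  haveI : P.IsPrime := Ideal.comap_isPrime _ _
  have hpA : (p : K) ∈ A := ⟨p, by simp [ι]⟩
  have hpP : (⟨(p : K), hpA⟩ : A) ∈ P := by
    change e.symm ⟨(p : K), hpA⟩ ∈ Ideal.span {(p : ℤ)}
    have : e.symm ⟨(p : K), hpA⟩ = p := by
      apply e.injective
      rw [RingEquiv.apply_symm_apply]
      apply Subtype.ext
      simp [e, ι]
    rw [this]
    exact Ideal.mem_span_singleton_self _
  -- localise and dominate by a valuation ring
  let Aloc : LocalSubring K := LocalSubring.ofPrime A P
  obtain ⟨B, hB⟩ := Aloc.exists_le_valuationSubring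
  obtain ⟨hle, hloc⟩ := LocalSubring.le_def.mp hB
  have hpAloc : (p : K) ∈ Aloc.toSubring := LocalSubring.le_ofPrime A P hpA
  have hpB : (p : K) ∈ B := hle hpAloc
  -- `p` lies in the maximal ideal of the localisation, hence is a non-unit there
  have hmax : (⟨(p : K), hpAloc⟩ : Aloc.toSubring) ∈ IsLocalRing.maximalIdeal Aloc.toSubring := by
    have := (IsLocalization.AtPrime.to_map_mem_maximal_iff Aloc.toSubring P ⟨(p : K), hpA⟩).mpr hpP
    convert this using 1
    exact Subtype.ext rfl
  have hnu : ¬ IsUnit (Subring.inclusion hle ⟨(p : K), hpAloc⟩) := fun hu =>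
    ((IsLocalRing.mem_maximalIdeal _).mp hmax) (hloc.map_nonunit _ hu)
  refine ⟨B, ?_⟩
  -- if the valuation of `p` were `1`, `p` would be a unit of `B`
  rcases (B.valuation_le_one ⟨(p : K), hpB⟩).lt_or_eq with hlt | heq
  · simpa using hlt
  · exfalso
    apply hnu
    obtain ⟨u, hu⟩ := (B.valuation_eq_one_iff ⟨(p : K), hpB⟩).mpr heq
    refine isUnit_iff_exists_inv.mpr ⟨⟨((u⁻¹ : Bˣ) : B), ((u⁻¹ : Bˣ) : B).2⟩, Subtype.ext ?_⟩
    have h1 : ((u : B) : K) * (((u⁻¹ : Bˣ) : B) : K) = 1 := by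
      rw [← Subring.coe_mul B.toSubring]
      change (((u * u⁻¹ : Bˣ) : B) : K) = 1
      rw [mul_inv_cancel, Units.val_one, OneMemClass.coe_one]
    have h2 : ((u : B) : K) = p := congrArg Subtype.val hu
    rw [h2] at h1
    exact h1

/-- **Reduction modulo `p` of common projective zeros.** If homogeneous polynomials `f t` with
integer coefficients have a common zero `z ≠ 0` over a field `K` of characteristic `0`, then for
every prime `p` they have a common zero `w ≠ 0` over some field of characteristic `p`. [folklore] -/
theorem exists_charP_commonZero {σ : Type*} [Fintype σ] {K : Type u} [Field K] [CharZero K]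
    {ι : Type*} (f : ι → MvPolynomial σ ℤ) (d : ι → ℕ) (hf : ∀ t, (f t).IsHomogeneous (d t))
    (z : σ → K) (hz : z ≠ 0) (hzero : ∀ t, aeval z (f t) = 0) (p : ℕ) (hp : p.Prime) :
    ∃ (L : Type u) (_ : Field L) (_ : CharP L p) (w : σ → L), w ≠ 0 ∧ ∀ t, aeval w (f t) = 0 := by
  classical
  obtain ⟨B, hpB⟩ := exists_valuationSubring_lt_one K p hp
  -- a coordinate of largest valuation
  obtain ⟨i₀, hi₀⟩ : ∃ i, z i ≠ 0 := by
    by_contra h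
    push Not at h
    exact hz (funext h)
  obtain ⟨j, -, hj⟩ :=
    Finset.exists_max_image Finset.univ (fun i => B.valuation (z i)) ⟨i₀, Finset.mem_univ _⟩
  have hzj : z j ≠ 0 := by
    intro h
    have h1 := hj i₀ (Finset.mem_univ _)
    rw [h, map_zero] at h1
    exact hi₀ ((Valuation.zero_iff _).mp (le_antisymm h1 zero_le))
  -- rescaled coordinates lie in `B`
  have hmem : ∀ i, z i / z j ∈ B := by
    intro i
    rw [← B.valuation_le_one_iff, map_div₀]
    exact div_le_one_of_le₀ (hj i (Finset.mem_univ _)) zero_le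
  let wt : σ → B := fun i => ⟨z i / z j, hmem i⟩
  have hwt : ∀ t, aeval wt (f t) = 0 := by
    intro t
    apply Subtype.val_injective
    have h1 : ((aeval wt (f t) : B) : K) = aeval (fun i => ((wt i : B) : K)) (f t) := by
      have key := MvPolynomial.eval₂_comp_left B.subtype (algebraMap ℤ B) wt (f t)
      rw [RingHom.ext_int (B.subtype.comp (algebraMap ℤ B)) (algebraMap ℤ K)] at key
      rw [MvPolynomial.aeval_def, MvPolynomial.aeval_def]
      exact key
    rw [h1, ZeroMemClass.coe_zero]
    have h2 : (fun i => ((wt i : B) : K)) = (z j)⁻¹ • z := by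
      funext i
      simp [wt, div_eq_inv_mul]
    rw [h2, aeval_smul_of_isHomogeneous (hf t), hzero t, mul_zero]
  -- reduce to the residue field
  let L := IsLocalRing.ResidueField B
  have hpmax : (⟨(p : K), (B.valuation_le_one_iff _).mp hpB.le⟩ : B) ∈
      IsLocalRing.maximalIdeal B := (B.valuation_lt_one_iff _).mpr (by simpa using hpB)
  have hchar : CharP L p := by
    refine (CharP.charP_iff_prime_eq_zero hp).mpr ?_
    have : (p : L) = IsLocalRing.residue B ⟨(p : K), (B.valuation_le_one_iff _).mp hpB.le⟩ := by
      rw [← map_natCast (IsLocalRing.residue B) p]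
      congr 1
    rw [this, IsLocalRing.residue_eq_zero_iff]
    exact hpmax
  refine ⟨L, inferInstance, hchar, fun i => IsLocalRing.residue B (wt i), ?_, ?_⟩
  · intro h
    have h1 := congr_fun h j
    have h2 : wt j = 1 := Subtype.ext (div_self hzj)
    rw [h2, map_one, Pi.zero_apply] at h1
    exact one_ne_zero h1
  · intro t
    have key := MvPolynomial.eval₂_comp_left (IsLocalRing.residue B) (algebraMap ℤ B) wt (f t)
    rw [RingHom.ext_int ((IsLocalRing.residue B).comp (algebraMap ℤ B)) (algebraMap ℤ L),
      ← MvPolynomial.aeval_def, hwt t, map_zero] at key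
    rw [MvPolynomial.aeval_def]
    exact key.symm

end Summit.ValiantsHypothesis.ValiantsHypothesis.Theorems.GrenetZeonHessianRankCodimTwo
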